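import Literature.LinearAlgebra.Matrix.QInversiveCharpoly
import Literature.LinearAlgebra.Matrix.Bezoutian
import Literature.LinearAlgebra.Matrix.SymplecticGroupGeneration
import HarnessLib

/-!
# A `q`-inversive companion element of `GSp_{2n}` with prescribed `q`-palindromic characteristic polynomial
# (Goresky–Tai 2017, Proposition 38 and Corollary 39; §4.2 (4.2))

Topic `Literature/LinearAlgebra/Matrix`; THEOREMS ONLY (no definition, no instance, no named fact; D-0026 net
debt 0).  Lane `lit-hodgefound` (summit `HodgeConjecture`, Track 2 foundations library), seat
`lit-hodgefound-p15`, generation 56, row g56-#4; sequel of `QInversiveCharpoly` (g56-#3: the block relations and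
`p_γ = xⁿ p_{2A}(x + q/x)`), of `Literature.Algebra.Polynomial.QPalindromicRealCounterpart` (g56-#1: every
`q`-palindromic `p` is `xⁿ h(x + q/x)`), and of the tree's `CompanionMatrix` / `Bezoutian` (the companion matrix
`C_h` and its unimodular Hankel symmetriser `B(1,h)`, `C_h B(1,h) = B(1,h) ᵗC_h`) and `SymplecticGroupGeneration`
(`levi u = (u 0; 0 ᵗu⁻¹)`).

THE PRINT.  M. Goresky, Y.-S. Tai, *Real structures on ordinary Abelian varieties*, arXiv:1701.07742
[GoreskyTai2017RealStructuresOrdinary], §4.2 (p0011) and App. §16.2 (p0037–p0038), verbatim: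

> §4.2 … Let `L ⊃ ℚ` be a field and let `γ = (A B; C ᵗA) ∈ GSp_{2n}(L)`. Let `x = (λX 0; 0 ᵗX⁻¹) ∈ GL*_n(L)`.
> Then `xγx⁻¹ = (XAX⁻¹, λXBᵗX; (1/λ)ᵗX⁻¹CX⁻¹, ᵗX⁻¹ᵗAᵗX)` (4.2). It follows that `γ` is `q`-inversive if and
> only if `xγx⁻¹` is `q`-inversive.
> The following proposition is a converse to Lemma 37. It provides a companion matrix for the symplectic group …
> the following construction provides a matrix representative `γ` that is also `q`-inversive, meaning that
> `τ₀γτ₀⁻¹ = qγ⁻¹`.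
> **Proposition 38.** Let `p(x) = Σ_{i=0}^{2n} a_i x^i ∈ ℚ[x]` be a `q`-palindromic polynomial of degree `2n`. Then
> there exists an element `γ ∈ GSp_{2n}(ℚ)` with multiplier `q`, whose characteristic polynomial is `p(x)`.
> Moreover, `γ` may be chosen to be semisimple, in which case it is uniquely determined up to conjugacy in
> `GSp_{2n}(ℚ̄)` by its characteristic polynomial `p(x)`.
> *Proof.* … define `h(x) = ∏ (x − α_i) = −h₀ − h₁x − ⋯ − h_{n−1}x^{n−1} + xⁿ` … The desired element is
> `γ = (A B; C ᵗA)` where … `A` is the companion matrix for the polynomial `h(x)` … `B` is symmetric and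
> nonsingular, and one checks directly that `AB = BᵗA`. Define `C = B⁻¹(A² − qI)` so that `A² − BC = qI`. These
> conditions guarantee that `γ ∈ GSp_{2n}(ℚ)`, its multiplier is `q`, and it is [`q`-inversive]. Since the
> characteristic polynomial of `A` is `h(x)`, Lemma 12 implies that the characteristic polynomial of `γ` is `p(x)`.
> **Corollary 39.** Let `A₀ ∈ GL_n(ℚ)` be semisimple and suppose that its characteristic polynomial is an ordinary
> Weil `q`-polynomial. Then there exist `B₀, C₀` so that the matrix `γ₀ = (A₀ B₀; C₀ ᵗA₀)` is in `GSp_{2n}(ℚ)` and is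
> `q`-inversive and semisimple. *Proof.* … There exists `u ∈ GL_n(ℚ)` such that `A₀ = uAu⁻¹`. … Then
> `γ₀ = UγU⁻¹` has the desired properties, where `U = (u 0; 0 ᵗu⁻¹) ∈ Sp_{2n}(ℚ)`.

WHAT IS HERE (Mathlib's `J = (0 −1; 1 0)` — the displayed relations are unchanged; `n × n` blocks over a
commutative ring `R` unless said otherwise; «multiplier `q`» is `γᵀJγ = q·J`):
* §1 **THE COMPLETION** (the step «define `C = B⁻¹(A² − qI)`»), over any commutative ring: for ANY square `A`, any
  symmetric `S` with `det S` a unit and `AS = SᵗA`, and any `q`, the blocks `B = S`, `C = S⁻¹(A² − q·1)` are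
  symmetric and satisfy `AB = BᵗA`, `CA = ᵗAC`, `A² − BC = q·1` (`completion_relations`), so
  `γ = (A S; S⁻¹(A²−q) ᵗA)` has multiplier `q` (**`completion_multiplier`**) and is `q`-inversive; over an integral
  domain its characteristic polynomial is `xⁿ p_{2A}(x + q/x)` (`charpoly_completion`).
* §2 **PROPOSITION 38, existence** (**`exists_qInversive_charpoly_eq`**): over a FIELD `K` with `2 ≠ 0` (the
  source: `ℚ`), for every monic `q`-palindromic `p` of degree `2n` and EVERY `q ∈ K` there are `A, B, C ∈ M_n(K)`,
  `B, C` symmetric, `AB = BᵗA`, `CA = ᵗAC`, `A² − BC = q·1`, with `γ = (A B; C ᵗA)` of multiplier `q` and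
  `p_γ = p`.  The witness is `A = ½·C_h`, `B = B(1,h)` (the tree's Bezoutian/Hankel symmetriser of the companion
  matrix, which is ALWAYS unimodular), `C = B⁻¹(A² − q)`, where `p(x) = xⁿh(x + q/x)`.  SCOPE NOTES: (i) the
  printed `B` (last row and column `(0,…,0,1)`) is singular when `h(0) = 0` — e.g. `p = (x² + q)²`, `h = x²` —, so
  «`B` is symmetric and nonsingular» fails there; the Bezoutian symmetriser repairs this uniformly; (ii) the
  factor `½` is forced (`p_γ = xⁿ p_{2A}(x+q/x)` for every `q`-inversive `γ`), which is why `2 ∈ K^×` is needed;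
  (iii) the «moreover» clause (a semisimple choice, unique up to `GSp_{2n}(ℚ̄)`-conjugacy) is NOT here.
* §3 **(4.2) and the transport of COROLLARY 39**: `levi u · (A B; C ᵗA) · levi u⁻¹ =
  (uAu⁻¹, uBᵗu; ᵗu⁻¹Cu⁻¹, ᵗ(uAu⁻¹))` (`levi_conj_fromBlocks`, the case `λ = 1` of (4.2)), the transported blocks
  again satisfy the `q`-inversive relations (**`relations_levi_conj`** — «`γ` is `q`-inversive iff `xγx⁻¹` is»),
  and COROLLARY 39 in the form actually proved by the printed argument: if `A₀ = uAu⁻¹` with `A` admitting a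
  unimodular symmetriser (e.g. `A = ½C_h`), then `A₀` has one too and hence a `q`-inversive completion
  (`exists_symmetrizer_of_conj`, **`exists_qInversive_of_conj_companion`**); the hypotheses «semisimple»,
  «ordinary Weil» of the print are not needed for this algebraic statement.

## References
* [GoreskyTai2017RealStructuresOrdinary] M. Goresky, Y.-S. Tai, Real structures on ordinary Abelian varieties,
  arXiv:1701.07742 (2017), §4.1–§4.2 (4.2) (p0011), App. §16.2 Proposition 38 and Corollary 39 with proofs
  (p0037–p0038).
-/

open Matrix Polynomial Finset
open Literature.Algebra.Polynomial

namespace Literature.LinearAlgebra.Matrix.QInversiveCompanion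

open Literature.LinearAlgebra.Matrix (companion charpoly_companion)
open Literature.LinearAlgebra.Matrix.Bezoutian (bezoutian bezoutian_transpose isUnit_det_bezoutian_one_left
  companion_mul_bezoutian_one_left)

variable {R : Type*} [CommRing R] {m : Type*} [Fintype m] [DecidableEq m]

/-! ## §1 The completion `C = S⁻¹(A² − q·1)` of a symmetrised matrix -/

/-- From `AS = SᵗA` with `det S` a unit: `S⁻¹A = ᵗA S⁻¹`. [cite: GoreskyTai2017RealStructuresOrdinary, App. §16.2 proof of Prop. 38 «one checks directly that AB = BᵗA» (p0037)] -/
theorem inv_mul_eq_transpose_mul_inv {A S : Matrix m m R} (hSu : IsUnit S.det) (hAS : A * S = S * Aᵀ) :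
    S⁻¹ * A = Aᵀ * S⁻¹ := by
  have h : S⁻¹ * (A * S) * S⁻¹ = S⁻¹ * (S * Aᵀ) * S⁻¹ := by rw [hAS]
  rwa [Matrix.mul_assoc, Matrix.mul_assoc, mul_nonsing_inv _ hSu, Matrix.mul_one, ← Matrix.mul_assoc S⁻¹ S Aᵀ,
    nonsing_inv_mul _ hSu, Matrix.one_mul] at h

/-- **The completion relations**: for `S` symmetric with unit determinant and `AS = SᵗA`, the blocks `B = S`,
`C = S⁻¹(A² − q·1)` are symmetric with `AB = BᵗA`, `CA = ᵗAC`, `A² − BC = q·1`.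
[cite: GoreskyTai2017RealStructuresOrdinary, App. §16.2 proof of Prop. 38 «Define C = B⁻¹(A² − qI) so that A² − BC = qI. These conditions guarantee that γ ∈ GSp_{2n}(ℚ), its multiplier is q» (p0037)] -/
theorem completion_relations {A S : Matrix m m R} (hS : Sᵀ = S) (hSu : IsUnit S.det) (hAS : A * S = S * Aᵀ)
    (q : R) :
    (S⁻¹ * (A * A - q • (1 : Matrix m m R)))ᵀ = S⁻¹ * (A * A - q • (1 : Matrix m m R)) ∧
      A * S = S * Aᵀ ∧
      S⁻¹ * (A * A - q • (1 : Matrix m m R)) * A = Aᵀ * (S⁻¹ * (A * A - q • (1 : Matrix m m R))) ∧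
      A * A - S * (S⁻¹ * (A * A - q • (1 : Matrix m m R))) = q • (1 : Matrix m m R) := by
  have hSA := inv_mul_eq_transpose_mul_inv hSu hAS
  have hSit : S⁻¹ᵀ = S⁻¹ := by rw [transpose_nonsing_inv, hS]
  -- `S⁻¹ (A² − q) = (ᵗA² − q) S⁻¹`
  have hkey : S⁻¹ * (A * A - q • (1 : Matrix m m R)) = (Aᵀ * Aᵀ - q • (1 : Matrix m m R)) * S⁻¹ := by
    rw [Matrix.mul_sub, Matrix.sub_mul, ← Matrix.mul_assoc, hSA, Matrix.mul_assoc, hSA, ← Matrix.mul_assoc,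
      Matrix.mul_smul, Matrix.smul_mul, Matrix.mul_one, Matrix.one_mul]
  refine ⟨?_, hAS, ?_, ?_⟩
  · rw [transpose_mul, transpose_sub, transpose_mul, transpose_smul, transpose_one, hSit, ← hkey]
  · -- `(A² − q)A = A(A² − q)`
    have hcomm : (A * A - q • (1 : Matrix m m R)) * A = A * (A * A - q • (1 : Matrix m m R)) := by
      rw [Matrix.sub_mul, Matrix.mul_sub, Matrix.smul_mul, Matrix.mul_smul, Matrix.one_mul, Matrix.mul_one,
        Matrix.mul_assoc]
    rw [Matrix.mul_assoc, hcomm, ← Matrix.mul_assoc, hSA, Matrix.mul_assoc]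
  · rw [mul_nonsing_inv_cancel_left _ _ hSu, sub_sub_cancel]

/-- **The completed element has multiplier `q`**: `γ = (A S; S⁻¹(A² − q) ᵗA)` satisfies `ᵗγJγ = qJ` (and is
`q`-inversive by construction). [cite: GoreskyTai2017RealStructuresOrdinary, App. §16.2 proof of Prop. 38 «These conditions guarantee that γ ∈ GSp_{2n}(ℚ), its multiplier is q, and it is [q-inversive]» (p0037)] -/
theorem completion_multiplier {A S : Matrix m m R} (hS : Sᵀ = S) (hSu : IsUnit S.det) (hAS : A * S = S * Aᵀ)
    (q : R) :
    (fromBlocks A S (S⁻¹ * (A * A - q • (1 : Matrix m m R))) Aᵀ)ᵀ * J m R *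
        fromBlocks A S (S⁻¹ * (A * A - q • (1 : Matrix m m R))) Aᵀ = q • J m R := by
  obtain ⟨hC, hAB, hCA, hq⟩ := completion_relations hS hSu hAS q
  exact (QInversiveCharpoly.relations_iff hS hC q).mpr ⟨hCA, hAB, hq⟩

/-- Over an integral domain the completed element has characteristic polynomial `xⁿ p_{2A}(x + q/x)`
(`2A = A + A`). [cite: GoreskyTai2017RealStructuresOrdinary, App. §16.2 proof of Prop. 38 «Since the characteristic polynomial of A is h(x), Lemma 12 implies that the characteristic polynomial of γ is p(x)» (p0037)] -/
theorem charpoly_completion [IsDomain R] {A S : Matrix m m R} (hS : Sᵀ = S) (hSu : IsUnit S.det)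
    (hAS : A * S = S * Aᵀ) (q : R) :
    (fromBlocks A S (S⁻¹ * (A * A - q • (1 : Matrix m m R))) Aᵀ).charpoly =
      ∑ j ∈ Finset.range (Fintype.card m + 1), Polynomial.C ((A + A).charpoly.coeff j) *
        X ^ (Fintype.card m - j) * (X ^ 2 + Polynomial.C q) ^ j := by
  obtain ⟨hC, hAB, hCA, hq⟩ := completion_relations hS hSu hAS q
  exact QInversiveCharpoly.charpoly_eq_transform_charpoly_two_smul hS hC hAB hCA hq

/-- **The printed completion `γ = (A, (A² − qI)C⁻¹; C, ᵗA)`** (Lemma 12, converse part; the map `θ` of §4.3):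
for `C` symmetric with unit determinant and `ᵗA C = C A`, the blocks `B = (A² − q·1)C⁻¹` and `C` are symmetric
with `AB = BᵗA`, `CA = ᵗAC`, `A² − BC = q·1`.
[cite: GoreskyTai2017RealStructuresOrdinary, §4.1 Lemma 12 «for any symmetric nonsingular matrix C ∈ GL_n(ℚ) such that ᵗAC = CA, the following element γ = (A, (A² − qI)C⁻¹; C, ᵗA) ∈ GSp_{2n}(ℚ) is q-inversive» (p0011); §4.3 (the map θ, «B = (A₀² − qI)C⁻¹») (p0012)] -/
theorem completion_relations_left {A T : Matrix m m R} (hT : Tᵀ = T) (hTu : IsUnit T.det)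
    (hAT : Aᵀ * T = T * A) (q : R) :
    ((A * A - q • (1 : Matrix m m R)) * T⁻¹)ᵀ = (A * A - q • (1 : Matrix m m R)) * T⁻¹ ∧
      A * ((A * A - q • (1 : Matrix m m R)) * T⁻¹) = (A * A - q • (1 : Matrix m m R)) * T⁻¹ * Aᵀ ∧
      T * A = Aᵀ * T ∧
      A * A - (A * A - q • (1 : Matrix m m R)) * T⁻¹ * T = q • (1 : Matrix m m R) := by
  have hTA : T⁻¹ * Aᵀ = A * T⁻¹ := by
    have h := inv_mul_eq_transpose_mul_inv (A := Aᵀ) (S := T) hTu (by rw [transpose_transpose]; exact hAT)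
    rwa [transpose_transpose] at h
  have hcomm : (A * A - q • (1 : Matrix m m R)) * A = A * (A * A - q • (1 : Matrix m m R)) := by
    rw [Matrix.sub_mul, Matrix.mul_sub, Matrix.smul_mul, Matrix.mul_smul, Matrix.one_mul, Matrix.mul_one,
      Matrix.mul_assoc]
  refine ⟨?_, ?_, hAT.symm, ?_⟩
  · rw [transpose_mul, transpose_nonsing_inv, hT, transpose_sub, transpose_mul, transpose_smul, transpose_one,
      Matrix.mul_sub, Matrix.sub_mul, ← Matrix.mul_assoc, hTA, Matrix.mul_assoc, hTA, ← Matrix.mul_assoc,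
      Matrix.mul_smul, Matrix.smul_mul, Matrix.mul_one, Matrix.one_mul]
  · rw [← Matrix.mul_assoc, ← hcomm, Matrix.mul_assoc, ← hTA, ← Matrix.mul_assoc]
  · rw [nonsing_inv_mul_cancel_right _ _ hTu, sub_sub_cancel]

/-- The printed completion has multiplier `q`: `γ = (A, (A² − q)C⁻¹; C, ᵗA)` satisfies `ᵗγJγ = qJ`.
[cite: GoreskyTai2017RealStructuresOrdinary, §4.1 Lemma 12 «the following element γ = (A, (A² − qI)C⁻¹; C, ᵗA) ∈ GSp_{2n}(ℚ) is q-inversive» (p0011)] -/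
theorem completion_multiplier_left {A T : Matrix m m R} (hT : Tᵀ = T) (hTu : IsUnit T.det)
    (hAT : Aᵀ * T = T * A) (q : R) :
    (fromBlocks A ((A * A - q • (1 : Matrix m m R)) * T⁻¹) T Aᵀ)ᵀ * J m R *
        fromBlocks A ((A * A - q • (1 : Matrix m m R)) * T⁻¹) T Aᵀ = q • J m R := by
  obtain ⟨hB, hAB, hTA, hq⟩ := completion_relations_left hT hTu hAT q
  exact (QInversiveCharpoly.relations_iff hB hT q).mpr ⟨hTA, hAB, hq⟩

/-! ## §2 Proposition 38: the companion element -/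

/-- A monic `h` of degree `n` in the shape used by the tree's `companion`: `h = xⁿ + Σ_{i<n} h_i xⁱ`. [folklore] -/
private theorem eq_X_pow_add_sum {h : R[X]} {n : ℕ} (hm : h.Monic) (hn : h.natDegree = n) :
    h = X ^ n + ∑ i : Fin n, Polynomial.C (h.coeff i) * X ^ (i : ℕ) := by
  rw [Fin.sum_univ_eq_sum_range (fun i => Polynomial.C (h.coeff i) * X ^ i) n, ← hn]
  exact hm.as_sum

section Field

variable {K : Type*} [Field K]

/-- **The symmetrised companion matrix**: for a monic `h = xⁿ + Σ h_i xⁱ` over a field with `2 ≠ 0`, the matrix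
`A = ½·C_h` and the Hankel symmetriser `S = B(1,h)` satisfy `ᵗS = S`, `det S ∈ K^×`, `AS = SᵗA` and `p_{2A} = h`
(the printed `A` and `B`, with `B` replaced by the always-nonsingular Bezoutian symmetriser).
[cite: GoreskyTai2017RealStructuresOrdinary, App. §16.2 proof of Prop. 38 «The matrix A is the companion matrix for the polynomial h(x) … B is symmetric and nonsingular, and one checks directly that AB = BᵗA» (p0037)] -/
theorem companion_symmetrizer (h2 : (2 : K) ≠ 0) {n : ℕ} (a : Fin n → K) :
    (bezoutian n 1 (X ^ n + ∑ i : Fin n, Polynomial.C (a i) * X ^ (i : ℕ)))ᵀ =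
        bezoutian n 1 (X ^ n + ∑ i : Fin n, Polynomial.C (a i) * X ^ (i : ℕ)) ∧
      IsUnit (bezoutian n 1 (X ^ n + ∑ i : Fin n, Polynomial.C (a i) * X ^ (i : ℕ))).det ∧
      ((2⁻¹ : K) • companion a) * bezoutian n 1 (X ^ n + ∑ i : Fin n, Polynomial.C (a i) * X ^ (i : ℕ)) =
        bezoutian n 1 (X ^ n + ∑ i : Fin n, Polynomial.C (a i) * X ^ (i : ℕ)) *
          ((2⁻¹ : K) • companion a)ᵀ ∧
      ((2⁻¹ : K) • companion a + (2⁻¹ : K) • companion a).charpoly =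
        X ^ n + ∑ i : Fin n, Polynomial.C (a i) * X ^ (i : ℕ) := by
  refine ⟨bezoutian_transpose _ _ _, isUnit_det_bezoutian_one_left a, ?_, ?_⟩
  · rw [Matrix.smul_mul, companion_mul_bezoutian_one_left, transpose_smul, Matrix.mul_smul]
  · rw [← add_smul, ← two_mul, mul_inv_cancel₀ h2, one_smul, charpoly_companion]

/-- **Proposition 38 (existence of a `q`-inversive companion element).** Over a field `K` with `2 ≠ 0`, for every
monic `q`-palindromic `p` of degree `2n` (any `q ∈ K`) there are `A, B, C ∈ M_n(K)` with `B, C` symmetric,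
`AB = BᵗA`, `CA = ᵗAC`, `A² − BC = q·1` — so `γ = (A B; C ᵗA)` is `q`-inversive — such that `γ` has multiplier
`q` (`ᵗγJγ = qJ`) and characteristic polynomial `p`.
[cite: GoreskyTai2017RealStructuresOrdinary, App. §16.2 Proposition 38 «there exists an element γ ∈ GSp_{2n}(ℚ) with multiplier q, whose characteristic polynomial is p(x) … a matrix representative γ that is also q-inversive» (p0037)] -/
theorem exists_qInversive_charpoly_eq (h2 : (2 : K) ≠ 0) (q : K) {n : ℕ} {p : K[X]} (hpm : p.Monic)
    (hpd : p.natDegree = 2 * n) (hpal : ∀ r ≤ n, p.coeff (n - r) = q ^ r * p.coeff (n + r)) :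
    ∃ A B C : Matrix (Fin n) (Fin n) K, Bᵀ = B ∧ Cᵀ = C ∧ A * B = B * Aᵀ ∧ C * A = Aᵀ * C ∧
      A * A - B * C = q • (1 : Matrix (Fin n) (Fin n) K) ∧
      (fromBlocks A B C Aᵀ)ᵀ * J (Fin n) K * fromBlocks A B C Aᵀ = q • J (Fin n) K ∧
      (fromBlocks A B C Aᵀ).charpoly = p := by
  -- the real counterpart `h`: `p = xⁿ h(x + q/x)`
  obtain ⟨h, ⟨⟨hm, hn⟩, hp⟩, -⟩ := QPalindromicRealCounterpart.existsUnique_monic_eq_transform q n p hpm hpd hpal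
  set a : Fin n → K := fun i => h.coeff i with ha
  have hh : h = X ^ n + ∑ i : Fin n, Polynomial.C (a i) * X ^ (i : ℕ) := eq_X_pow_add_sum hm hn
  obtain ⟨hS, hSu, hAS, hchar⟩ := companion_symmetrizer h2 a
  set A : Matrix (Fin n) (Fin n) K := (2⁻¹ : K) • companion a with hA
  set S : Matrix (Fin n) (Fin n) K := bezoutian n 1 (X ^ n + ∑ i : Fin n, Polynomial.C (a i) * X ^ (i : ℕ))
    with hSdef
  obtain ⟨hC, hAB, hCA, hq⟩ := completion_relations hS hSu hAS q
  refine ⟨A, S, S⁻¹ * (A * A - q • 1), hS, hC, hAB, hCA, hq, completion_multiplier hS hSu hAS q, ?_⟩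
  rw [charpoly_completion hS hSu hAS q, hchar, ← hh, hp]
  simp only [Fintype.card_fin]

end Field

/-! ## §3 (4.2): transport by `U = (u 0; 0 ᵗu⁻¹)`, and Corollary 39 -/

/-- **(4.2) for `λ = 1`**: `levi u · (A B; C ᵗA) · levi u⁻¹ = (uAu⁻¹, uBᵗu; ᵗu⁻¹Cu⁻¹, ᵗ(uAu⁻¹))` for `det u` a
unit (`levi u = (u 0; 0 ᵗu⁻¹)`). [cite: GoreskyTai2017RealStructuresOrdinary, §4.2 (4.2) (p0011)] -/
theorem levi_conj_fromBlocks {u : Matrix m m R} (hu : IsUnit u.det) (A B C : Matrix m m R) :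
    Sp.levi u * fromBlocks A B C Aᵀ * Sp.levi u⁻¹ =
      fromBlocks (u * A * u⁻¹) (u * B * uᵀ) (u⁻¹ᵀ * C * u⁻¹) (u * A * u⁻¹)ᵀ := by
  rw [Sp.levi, Sp.levi, nonsing_inv_nonsing_inv _ hu, fromBlocks_multiply, fromBlocks_multiply]
  simp only [Matrix.zero_mul, Matrix.mul_zero, add_zero, zero_add]
  congr 1
  rw [transpose_mul, transpose_mul, transpose_nonsing_inv, Matrix.mul_assoc]

/-- **«`γ` is `q`-inversive if and only if `xγx⁻¹` is»** (the transported blocks satisfy the relations): for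
`det u` a unit, if `B, C` are symmetric with `AB = BᵗA`, `CA = ᵗAC`, `A² − BC = q·1`, then so are
`A' = uAu⁻¹`, `B' = uBᵗu`, `C' = ᵗu⁻¹Cu⁻¹`. [cite: GoreskyTai2017RealStructuresOrdinary, §4.2 «It follows that γ is q-inversive if and only if xγx⁻¹ is q-inversive» (p0011)] -/
theorem relations_levi_conj {u : Matrix m m R} (hu : IsUnit u.det) {A B C : Matrix m m R} {q : R}
    (hB : Bᵀ = B) (hC : Cᵀ = C) (hAB : A * B = B * Aᵀ) (hCA : C * A = Aᵀ * C)
    (hq : A * A - B * C = q • (1 : Matrix m m R)) :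
    (u * B * uᵀ)ᵀ = u * B * uᵀ ∧ (u⁻¹ᵀ * C * u⁻¹)ᵀ = u⁻¹ᵀ * C * u⁻¹ ∧
      (u * A * u⁻¹) * (u * B * uᵀ) = (u * B * uᵀ) * (u * A * u⁻¹)ᵀ ∧
      (u⁻¹ᵀ * C * u⁻¹) * (u * A * u⁻¹) = (u * A * u⁻¹)ᵀ * (u⁻¹ᵀ * C * u⁻¹) ∧
      (u * A * u⁻¹) * (u * A * u⁻¹) - (u * B * uᵀ) * (u⁻¹ᵀ * C * u⁻¹) = q • (1 : Matrix m m R) := by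
  have h1 : u⁻¹ * u = 1 := nonsing_inv_mul _ hu
  have h2 : u * u⁻¹ = 1 := mul_nonsing_inv _ hu
  have h3 : uᵀ * u⁻¹ᵀ = 1 := by rw [← transpose_mul, h1, transpose_one]
  have h4 : u⁻¹ᵀ * uᵀ = 1 := by rw [← transpose_mul, h2, transpose_one]
  refine ⟨?_, ?_, ?_, ?_, ?_⟩
  · rw [transpose_mul, transpose_mul, transpose_transpose, hB, Matrix.mul_assoc]
  · rw [transpose_mul, transpose_mul, transpose_transpose, hC, transpose_nonsing_inv, Matrix.mul_assoc]
  · -- `uAu⁻¹·uBᵗu = uABᵗu = uBᵗAᵗu = uBᵗu · ᵗu⁻¹ᵗAᵗu`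
    rw [transpose_mul, transpose_mul]
    calc u * A * u⁻¹ * (u * B * uᵀ) = u * A * (u⁻¹ * u) * B * uᵀ := by simp only [Matrix.mul_assoc]
      _ = u * (A * B) * uᵀ := by rw [h1, Matrix.mul_one, Matrix.mul_assoc u A B]
      _ = u * B * (uᵀ * u⁻¹ᵀ) * Aᵀ * uᵀ := by rw [hAB, h3, Matrix.mul_one, Matrix.mul_assoc u B Aᵀ]
      _ = u * B * uᵀ * (u⁻¹ᵀ * (Aᵀ * uᵀ)) := by simp only [Matrix.mul_assoc]
  · calc u⁻¹ᵀ * C * u⁻¹ * (u * A * u⁻¹) = u⁻¹ᵀ * C * (u⁻¹ * u) * A * u⁻¹ := by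
          simp only [Matrix.mul_assoc]
      _ = u⁻¹ᵀ * (C * A) * u⁻¹ := by rw [h1, Matrix.mul_one, Matrix.mul_assoc _ C A]
      _ = u⁻¹ᵀ * Aᵀ * (uᵀ * u⁻¹ᵀ) * C * u⁻¹ := by rw [hCA, h3, Matrix.mul_one, Matrix.mul_assoc _ Aᵀ C]
      _ = (u * A * u⁻¹)ᵀ * (u⁻¹ᵀ * C * u⁻¹) := by
          rw [transpose_mul, transpose_mul]; simp only [Matrix.mul_assoc]
  · calc u * A * u⁻¹ * (u * A * u⁻¹) - u * B * uᵀ * (u⁻¹ᵀ * C * u⁻¹)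
          = u * A * (u⁻¹ * u) * A * u⁻¹ - u * B * (uᵀ * u⁻¹ᵀ) * C * u⁻¹ := by simp only [Matrix.mul_assoc]
      _ = u * (A * A - B * C) * u⁻¹ := by
          rw [h1, h3, Matrix.mul_one, Matrix.mul_one, Matrix.mul_sub, Matrix.sub_mul]
          simp only [Matrix.mul_assoc]
      _ = q • (1 : Matrix m m R) := by rw [hq, Matrix.mul_smul, Matrix.mul_one, Matrix.smul_mul, h2]

/-- `levi u = (u 0; 0 ᵗu⁻¹)` lies in `Sp_{2n}` («`U ∈ Sp_{2n}(ℚ)`»; the tree's `Sp.levi_mem`).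
[cite: GoreskyTai2017RealStructuresOrdinary, App. §16.2 proof of Cor. 39 «U = (u 0; 0 ᵗu⁻¹) ∈ Sp_{2n}(ℚ)» (p0038)] -/
theorem levi_mem_symplecticGroup {u : Matrix m m R} (hu : IsUnit u.det) : Sp.levi u ∈ symplecticGroup m R :=
  Sp.levi_mem hu

/-- A unimodular symmetriser is transported along a similarity: if `AS = SᵗA` (`S` symmetric, `det S` a unit) and
`det u` is a unit then `A₀ = uAu⁻¹` has the symmetriser `uSᵗu`.
[cite: GoreskyTai2017RealStructuresOrdinary, App. §16.2 proof of Cor. 39 «There exists u ∈ GL_n(ℚ) such that A₀ = uAu⁻¹ … γ₀ = UγU⁻¹» (p0038)] -/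
theorem exists_symmetrizer_of_conj {u A S : Matrix m m R} (hu : IsUnit u.det) (hS : Sᵀ = S)
    (hSu : IsUnit S.det) (hAS : A * S = S * Aᵀ) :
    (u * S * uᵀ)ᵀ = u * S * uᵀ ∧ IsUnit (u * S * uᵀ).det ∧
      (u * A * u⁻¹) * (u * S * uᵀ) = (u * S * uᵀ) * (u * A * u⁻¹)ᵀ := by
  refine ⟨by rw [transpose_mul, transpose_mul, transpose_transpose, hS, Matrix.mul_assoc], ?_, ?_⟩
  · rw [det_mul, det_mul, det_transpose]
    exact (hu.mul hSu).mul hu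
  · have h1 : u⁻¹ * u = 1 := nonsing_inv_mul _ hu
    have h3 : uᵀ * u⁻¹ᵀ = 1 := by rw [← transpose_mul, h1, transpose_one]
    rw [transpose_mul, transpose_mul]
    calc u * A * u⁻¹ * (u * S * uᵀ) = u * A * (u⁻¹ * u) * S * uᵀ := by simp only [Matrix.mul_assoc]
      _ = u * (A * S) * uᵀ := by rw [h1, Matrix.mul_one, Matrix.mul_assoc u A S]
      _ = u * S * (uᵀ * u⁻¹ᵀ) * Aᵀ * uᵀ := by rw [hAS, h3, Matrix.mul_one, Matrix.mul_assoc u S Aᵀ]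
      _ = u * S * uᵀ * (u⁻¹ᵀ * (Aᵀ * uᵀ)) := by simp only [Matrix.mul_assoc]

/-- **Corollary 39 (algebraic form).** Any `A₀` that admits a unimodular symmetric `S₀` with `A₀S₀ = S₀ᵗA₀` has,
for every `q`, a `q`-inversive completion `γ₀ = (A₀ B₀; C₀ ᵗA₀)` of multiplier `q` (`B₀ = S₀`,
`C₀ = S₀⁻¹(A₀² − q)`). [cite: GoreskyTai2017RealStructuresOrdinary, App. §16.2 Corollary 39 «there exist B₀, C₀ so that the matrix γ₀ = (A₀ B₀; C₀ ᵗA₀) is in GSp_{2n}(ℚ) and is q-inversive» (p0038)] -/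
theorem exists_qInversive_of_symmetrizer {A₀ S₀ : Matrix m m R} (hS : S₀ᵀ = S₀) (hSu : IsUnit S₀.det)
    (hAS : A₀ * S₀ = S₀ * A₀ᵀ) (q : R) :
    ∃ B₀ C₀ : Matrix m m R, B₀ᵀ = B₀ ∧ C₀ᵀ = C₀ ∧ A₀ * B₀ = B₀ * A₀ᵀ ∧ C₀ * A₀ = A₀ᵀ * C₀ ∧
      A₀ * A₀ - B₀ * C₀ = q • (1 : Matrix m m R) ∧
      (fromBlocks A₀ B₀ C₀ A₀ᵀ)ᵀ * J m R * fromBlocks A₀ B₀ C₀ A₀ᵀ = q • J m R := by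
  obtain ⟨hC, hAB, hCA, hq⟩ := completion_relations hS hSu hAS q
  exact ⟨S₀, S₀⁻¹ * (A₀ * A₀ - q • 1), hS, hC, hAB, hCA, hq, completion_multiplier hS hSu hAS q⟩

section Field

variable {K : Type*} [Field K]

/-- **Corollary 39 along the printed route** (field with `2 ≠ 0`): if `A₀ = u(½C_h)u⁻¹` is similar to the
halved companion matrix of a monic `h = xⁿ + Σ h_i xⁱ`, then for every `q` there are symmetric `B₀, C₀` with
`γ₀ = (A₀ B₀; C₀ ᵗA₀)` `q`-inversive of multiplier `q` and `p_{γ₀} = xⁿ h(x + q/x)`.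
[cite: GoreskyTai2017RealStructuresOrdinary, App. §16.2 Corollary 39 and proof «A₀ = uAu⁻¹ … γ₀ = UγU⁻¹ has the desired properties» (p0038)] -/
theorem exists_qInversive_of_conj_companion (h2 : (2 : K) ≠ 0) {n : ℕ} (a : Fin n → K)
    {u A₀ : Matrix (Fin n) (Fin n) K} (hu : IsUnit u.det) (hA₀ : A₀ = u * ((2⁻¹ : K) • companion a) * u⁻¹)
    (q : K) :
    ∃ B₀ C₀ : Matrix (Fin n) (Fin n) K, B₀ᵀ = B₀ ∧ C₀ᵀ = C₀ ∧ A₀ * B₀ = B₀ * A₀ᵀ ∧ C₀ * A₀ = A₀ᵀ * C₀ ∧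
      A₀ * A₀ - B₀ * C₀ = q • (1 : Matrix (Fin n) (Fin n) K) ∧
      (fromBlocks A₀ B₀ C₀ A₀ᵀ)ᵀ * J (Fin n) K * fromBlocks A₀ B₀ C₀ A₀ᵀ = q • J (Fin n) K ∧
      (fromBlocks A₀ B₀ C₀ A₀ᵀ).charpoly =
        ∑ j ∈ Finset.range (n + 1), Polynomial.C ((X ^ n + ∑ i : Fin n,
          Polynomial.C (a i) * X ^ (i : ℕ)).coeff j) * X ^ (n - j) * (X ^ 2 + Polynomial.C q) ^ j := by
  obtain ⟨hS, hSu, hAS, hchar⟩ := companion_symmetrizer h2 a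
  obtain ⟨hS₀, hS₀u, hA₀S₀⟩ := exists_symmetrizer_of_conj hu hS hSu hAS
  rw [← hA₀] at hA₀S₀
  obtain ⟨hC, hAB, hCA, hq⟩ := completion_relations hS₀ hS₀u hA₀S₀ q
  refine ⟨_, _, hS₀, hC, hAB, hCA, hq, completion_multiplier hS₀ hS₀u hA₀S₀ q, ?_⟩
  rw [charpoly_completion hS₀ hS₀u hA₀S₀ q]
  have hAA : (A₀ + A₀).charpoly = X ^ n + ∑ i : Fin n, Polynomial.C (a i) * X ^ (i : ℕ) := by
    rw [← hchar, hA₀, ← Matrix.add_mul, ← Matrix.mul_add]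
    -- `u M u⁻¹` has the characteristic polynomial of `M`
    rw [Matrix.mul_assoc, Matrix.charpoly_mul_comm, Matrix.mul_assoc, nonsing_inv_mul _ hu, Matrix.mul_one]
  rw [hAA]
  simp only [Fintype.card_fin]

end Field

end Literature.LinearAlgebra.Matrix.QInversiveCompanion
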